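import Mathlib
import HarnessLib

/-!
# A reduced scheme mapping a dense set of points into a closed subscheme factors through it

Topic: `Literature/AlgebraicGeometry/Morphisms`.  Let `ι : Z ⟶ W` be a closed immersion, `ι' : Z' ⟶ W` a quasi-compact morphism
(e.g. another closed immersion) from a REDUCED scheme `Z'`, and `T ⊆ Z'` a (Zariski-)dense set of points with `ι'(T) ⊆ ι(Z)`.  Then
`ι'` factors (uniquely) through `ι`: `ι' = f ≫ ι`; in particular `ι'(Z') ⊆ ι(Z)`.  Proof: a section `s` of the ideal of `Z` pulls back
to a section of `Z'` whose non-vanishing locus `ι'⁻¹(D(s))` is an open subset missing the dense set `T`, hence empty; on the reduced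
scheme `Z'` this forces `ι'^*(s) = 0` (Mathlib `eq_zero_of_basicOpen_eq_bot`), so `ker ι ≤ ker ι'` and the universal property of
closed immersions (Mathlib `IsClosedImmersion.lift`) applies.  Typical use (cell hodgecm-mathlib, I-1′ planning line `F1ExtHodgeType`
v2, stub S5 (Z2)): `Z' = ` a Galois twist of a closed subvariety of a model `A ⊗_E ℂ`, `T = ` the twisted special points, known to land
in the subvariety by Shimura reciprocity.  Theorems only; pure Mathlib.

References: R. Hartshorne, *Algebraic Geometry*, II Ex. 3.11 (d) and Ex. 4.2 (reduced induced structure; morphisms agreeing on a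
dense set) [Hartshorne1977]; Stacks Project 01J3 / 0356 [StacksProject].  HC_CM is proved only modulo the 7 printed citations until
rung 0 closes; banked generic leaf toward I-1′ (XL), no floor change.
-/

noncomputable section

open CategoryTheory AlgebraicGeometry Topology TopologicalSpace

namespace Literature.AlgebraicGeometry.Morphisms

universe u

/-- **`ker ι ≤ ker ι'` from a dense set of points.**  For `ι : Z ⟶ W` any morphism, `ι' : Z' ⟶ W` quasi-compact with `Z'`
reduced, and `T ⊆ Z'` dense with `ι'(T) ⊆ range ι`: every local section of the kernel ideal sheaf of `ι` lies in the kernel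
ideal sheaf of `ι'` (its pull-back to the reduced `Z'` has empty non-vanishing locus). [cite: Hartshorne1977, II Ex. 4.2] -/
theorem ker_le_ker_of_dense {Z Z' W : Scheme.{u}} (ι : Z ⟶ W) (ι' : Z' ⟶ W) [QuasiCompact ι'] [IsReduced Z']
    (T : Set Z') (hT : Dense T) (h : ∀ z ∈ T, ι' z ∈ Set.range ι) : ι.ker ≤ ι'.ker := by
  rw [Scheme.IdealSheafData.le_def]
  intro U s hs
  rw [Scheme.Hom.ker_apply, RingHom.mem_ker]
  apply eq_zero_of_basicOpen_eq_bot
  rw [← Scheme.preimage_basicOpen]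
  -- the open `ι'⁻¹(D(s))` misses the dense set `T`, hence is empty
  by_contra hne
  have hne' : ((ι' ⁻¹ᵁ W.basicOpen s : Z'.Opens) : Set Z').Nonempty := by
    rw [Set.nonempty_iff_ne_empty, Ne, Opens.coe_eq_empty]
    exact hne
  obtain ⟨z, hzV, hzT⟩ := hT.inter_open_nonempty _ (ι' ⁻¹ᵁ W.basicOpen s).isOpen hne'
  have hzV' : ι' z ∈ W.basicOpen s := hzV
  obtain ⟨y, hy⟩ := h z hzT
  -- `ι' z = ι y` lies in the support of `ker ι`, i.e. in the zero locus of `s`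
  have hsupp : ι' z ∈ ι.ker.support := hy ▸ ι.range_subset_ker_support ⟨y, rfl⟩
  have hzU : ι' z ∈ (U : W.Opens) := W.basicOpen_le s hzV'
  rw [Scheme.IdealSheafData.mem_support_iff_of_mem hzU, Scheme.mem_zeroLocus_iff] at hsupp
  exact hsupp s hs hzV'

/-- **Factorisation through a closed immersion from a dense set of points.**  For a closed immersion `ι : Z ⟶ W`, a quasi-compact
`ι' : Z' ⟶ W` with `Z'` reduced, and a dense `T ⊆ Z'` with `ι'(T) ⊆ ι(Z)`, there is `f : Z' ⟶ Z` with `f ≫ ι = ι'` (Mathlib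
`IsClosedImmersion.lift` on `ker_le_ker_of_dense`). [cite: Hartshorne1977, II Ex. 3.11 (d) and Ex. 4.2] -/
theorem exists_fac_of_isClosedImmersion_of_dense {Z Z' W : Scheme.{u}} (ι : Z ⟶ W) (ι' : Z' ⟶ W) [IsClosedImmersion ι]
    [QuasiCompact ι'] [IsReduced Z'] (T : Set Z') (hT : Dense T) (h : ∀ z ∈ T, ι' z ∈ Set.range ι) :
    ∃ f : Z' ⟶ Z, f ≫ ι = ι' :=
  ⟨IsClosedImmersion.lift ι ι' (ker_le_ker_of_dense ι ι' T hT h),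
    IsClosedImmersion.lift_fac ι ι' (ker_le_ker_of_dense ι ι' T hT h)⟩

/-- **Set-theoretic corollary: `ι'(Z') ⊆ ι(Z)`** as soon as a dense set of points of the reduced `Z'` lands in `ι(Z)`.
[cite: Hartshorne1977, II Ex. 4.2] -/
theorem range_subset_range_of_dense {Z Z' W : Scheme.{u}} (ι : Z ⟶ W) (ι' : Z' ⟶ W) [IsClosedImmersion ι]
    [QuasiCompact ι'] [IsReduced Z'] (T : Set Z') (hT : Dense T) (h : ∀ z ∈ T, ι' z ∈ Set.range ι) :
    Set.range ι' ⊆ Set.range ι := by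
  obtain ⟨f, hf⟩ := exists_fac_of_isClosedImmersion_of_dense ι ι' T hT h
  rintro _ ⟨z, rfl⟩
  refine ⟨f z, ?_⟩
  rw [← Scheme.Hom.comp_apply, hf]

/-- The factorisation is unique (a closed immersion is a monomorphism). [cite: Hartshorne1977, II Ex. 4.2] -/
theorem fac_unique {Z Z' W : Scheme.{u}} (ι : Z ⟶ W) [IsClosedImmersion ι] {f g : Z' ⟶ Z} (hf : f ≫ ι = g ≫ ι) : f = g :=
  (cancel_mono ι).mp hf

end Literature.AlgebraicGeometry.Morphisms

end
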